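import Summits.CriticalPhenomena.PercolationContinuityZ3.Theorems.PercNearOneGluingNoHeavyLowerTailStarSetAggregation
import HarnessLib

/-!
# `NoHeavyLowerTail` (stmt-CriticalPhenomena-4575) — generic load lemma for a family of the charging scheme (U1-PROOF.md §9; blueprint F5)

Support file (prover `prim-gen-swap` gen 13; `--supports stmt-CriticalPhenomena-4575`).  No definitions, no named facts, no sorries.

The common shape of the per-family load bounds of the charging scheme for U1′_r (LEAN-BLUEPRINT-U1.md §C, §F5): a finite set `U` of units
`u = (S, X)` (configuration, hub), a resource map `res`, a "claimant key" `key` (e.g. the oriented pair (hub, partner)), and for every unit a set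
`cyl u ⊆ S` of classes that must be open, depending only on `(res u, key u)`.  If units with the same resource, key and configuration coincide,
every cylinder weight is at most `cap(res u)/c`, and at most `m` keys occur per resource, then (L2.2, `weighted_sum_le_cylinder_open`)
`Σ_{u∈U} W(S_u) ≤ (m/c)·Σ_{w ∈ res(U)} cap w`.  Instances: regular words (m,c) = (4,8), W-F rider words (1,32), W-C rider words (2,8),
W_bal words (1,2), A0 triangle words (3,128).

* `StarSet.key_class_load_le` — one (resource, key) class: `Σ W ≤ Π_{cyl} θ`;
* `StarSet.family_load_le` — the generic family bound.
-/

namespace Summit.CriticalPhenomena.PercolationContinuityZ3.Theorems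

open Finset
open scoped BigOperators

namespace StarSet

variable {ι : Type*} [Fintype ι] [DecidableEq ι]

/-- One claimant class: units with pairwise distinct configurations all containing `C₀` have total weight `≤ Π_{C₀} θ`. -/
theorem key_class_load_le (θ : ι → ℝ) (hθ0 : ∀ i, 0 ≤ θ i) (hθ1 : ∀ i, θ i ≤ 1) (Uk : Finset (Finset ι × ι)) (C₀ : Finset ι)
    (hcyl : ∀ u ∈ Uk, C₀ ⊆ u.1) (hinj : ∀ u ∈ Uk, ∀ v ∈ Uk, u.1 = v.1 → u = v) :
    ∑ u ∈ Uk, ((∏ k ∈ u.1, θ k) * ∏ k ∈ univ \ u.1, (1 - θ k)) ≤ ∏ k ∈ C₀, θ k := by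
  classical
  have hinj' : Set.InjOn (fun u : Finset ι × ι => u.1) ↑Uk := fun u hu v hv h => hinj u hu v hv h
  rw [← sum_image (f := fun S : Finset ι => (∏ k ∈ S, θ k) * ∏ k ∈ univ \ S, (1 - θ k)) hinj']
  set C := Uk.image (fun u : Finset ι × ι => u.1) with hC
  have h := weighted_sum_le_cylinder_open θ hθ0 hθ1 C₀ (fun S => if S ∈ C then (1 : ℝ) else 0)
    (fun S => by by_cases h : S ∈ C <;> simp [h]) (fun S hS => by
      by_cases h : S ∈ C
      · obtain ⟨u, hu, rfl⟩ := mem_image.1 h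
        exact hcyl u hu
      · simp [h] at hS)
  have hsub : C ⊆ (univ : Finset ι).powerset := fun S _ => mem_powerset.2 (subset_univ S)
  simp_rw [mul_boole] at h
  rw [sum_ite_mem, inter_eq_right.2 hsub] at h
  exact h

/-- **Generic family load bound (blueprint F5).**  See the file header. -/
theorem family_load_le {κ ρ : Type*} [DecidableEq κ] [DecidableEq ρ] (θ : ι → ℝ) (hθ0 : ∀ i, 0 ≤ θ i) (hθ1 : ∀ i, θ i ≤ 1)
    (U : Finset (Finset ι × ι)) (res : Finset ι × ι → ρ) (key : Finset ι × ι → κ) (cyl : Finset ι × ι → Finset ι)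
    (cap : ρ → ℝ) (hcap : ∀ u ∈ U, 0 ≤ cap (res u)) (m : ℕ) (c : ℝ) (hc : 0 < c)
    (hcyl : ∀ u ∈ U, cyl u ⊆ u.1)
    (hkey : ∀ u ∈ U, ∀ v ∈ U, res u = res v → key u = key v → cyl u = cyl v)
    (hinj : ∀ u ∈ U, ∀ v ∈ U, res u = res v → key u = key v → u.1 = v.1 → u = v)
    (hbound : ∀ u ∈ U, ∏ k ∈ cyl u, θ k ≤ cap (res u) / c)
    (hm : ∀ w ∈ U.image res, ((U.filter (fun u => res u = w)).image key).card ≤ m) :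
    ∑ u ∈ U, ((∏ k ∈ u.1, θ k) * ∏ k ∈ univ \ u.1, (1 - θ k)) ≤ (m / c) * ∑ w ∈ U.image res, cap w := by
  classical
  rw [mul_sum, ← sum_fiberwise_of_maps_to (fun u hu => mem_image_of_mem res hu)]
  refine sum_le_sum fun w hw => ?_
  have hcapw : 0 ≤ cap w := by
    obtain ⟨u, hu, rfl⟩ := mem_image.1 hw
    exact hcap u hu
  set Uw := U.filter (fun u => res u = w) with hUw
  -- split the fibre of `w` by key
  rw [← sum_fiberwise_of_maps_to (s := Uw) (t := Uw.image key) (g := key) (fun u hu => mem_image_of_mem key hu)]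
  have hper : ∀ k ∈ Uw.image key, ∑ u ∈ Uw.filter (fun u => key u = k), ((∏ j ∈ u.1, θ j) * ∏ j ∈ univ \ u.1, (1 - θ j)) ≤
      cap w / c := by
    intro k hk
    obtain ⟨u₀, hu₀, hu₀k⟩ := mem_image.1 hk
    have hu₀U : u₀ ∈ U := (mem_filter.1 hu₀).1
    have hu₀w : res u₀ = w := (mem_filter.1 hu₀).2
    have hle := key_class_load_le θ hθ0 hθ1 (Uw.filter (fun u => key u = k)) (cyl u₀)
      (fun u hu => by
        have hu' := mem_filter.1 hu
        have huU : u ∈ U := (mem_filter.1 hu'.1).1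
        have huw : res u = w := (mem_filter.1 hu'.1).2
        rw [hkey u₀ hu₀U u huU (hu₀w.trans huw.symm) (hu₀k.trans hu'.2.symm)]
        exact hcyl u huU)
      (fun u hu v hv huv => by
        have hu' := mem_filter.1 hu
        have hv' := mem_filter.1 hv
        exact hinj u (mem_filter.1 hu'.1).1 v (mem_filter.1 hv'.1).1
          ((mem_filter.1 hu'.1).2.trans (mem_filter.1 hv'.1).2.symm) (hu'.2.trans hv'.2.symm) huv)
    exact hle.trans (hu₀w ▸ hbound u₀ hu₀U)
  calc ∑ k ∈ Uw.image key, ∑ u ∈ Uw.filter (fun u => key u = k), ((∏ j ∈ u.1, θ j) * ∏ j ∈ univ \ u.1, (1 - θ j))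
      ≤ ∑ k ∈ Uw.image key, cap w / c := sum_le_sum hper
    _ = (Uw.image key).card * (cap w / c) := by rw [sum_const, nsmul_eq_mul]
    _ ≤ m * (cap w / c) := mul_le_mul_of_nonneg_right (by exact_mod_cast hm w hw) (div_nonneg hcapw hc.le)
    _ = m / c * cap w := by ring

end StarSet

end Summit.CriticalPhenomena.PercolationContinuityZ3.Theorems
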